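import Literature.NumberTheory.Automorphic.TorusCharacterSplitRigidityOffFinite   -- (this seat) `torusCharacter_eq_of_split_of_not_mem'` (split places OFF A FINITE SET)
import Literature.NumberTheory.Rogawski1990.OneDimAutRepHSplitRigidity            -- ★ `bcη_localComponent_eq_of_locη_eq`, `bcψ_localComponent_eq_of_locψ_eq`, `locη_eq_of_splitν₀_eq`; `OneDimAutRepH.ext`
import HarnessLib

/-!
# A one-dimensional automorphic `ξ = (η, ψ)` of `H = U(2) × U(1)` is determined by its split labels at one place above every split place OUTSIDE A FINITE SET
# (Rogawski 1990 §13.1 p. 199, §12.2 pp. 173–174; Cassels–Fröhlich Ch. VII §4 Prop. 4.1; Platonov–Rapinchuk §7.3 Prop. 7.8)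

Topic `NumberTheory/Rogawski1990`; namespace `Literature.NumberTheory.Rogawski1990.OneDimAutRepH`.  PROOF FILE (theorems only; no definition, no named fact,
no instance, no notation, no `sorry`); the cofinite companion of ★ `OneDimAutRepHSplitRigidity` (which asks the labels above EVERY split place) — the same
wrappers over `torusCharacter_eq_of_split_of_not_mem'` (★-companion `TorusCharacterSplitRigidityOffFinite`: the `c`-stable exceptional set joins the
weak-approximation set).  CM frame of ★ `OneDimAutRepH`: `ξ = (η, ψ)` a pair of automorphic characters of `U(1)_{L/L⁺}(𝔸_{L⁺})`, base changes `ξ.bcη = η̃`,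
`ξ.bcψ = ψ̃` (Hecke characters of `L`), split labels `ξ.locη w`, `ξ.locψ w`, `ξ.splitν₀ μω w` (★ D6 `GlobalAPacketMembership` §1).
* `ext_of_bc_localComponent_eq_of_split_of_not_mem'` — `η̃, ψ̃` agree at `w` or at `c̄ • w` for every moved `w` outside a finite `E` ⇒ `ξ = ξ′`.
* `ext_of_exists_bc_localComponent_eq_of_split_of_not_mem` — for every split `v ∉ S₁` (`S₁` a finite set of places of `L⁺`) SOME `w ∣ v` with `η̃_w = η̃′_w`, `ψ̃_w = ψ̃′_w`
  ⇒ `ξ = ξ′` (the fibre above a split `v` is `{w, c̄⁻¹ • w}`, ★ `PlacesOver.eq_or_eq_galInv`); label currencies `ext_of_locLabels_eq_of_split_of_not_mem`,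
  `ext_of_splitLabels_eq_of_split_of_not_mem` (`(splitν₀ μω, locψ)` for ONE auxiliary `μω`).
USE (crux H413, R90-TF S5∕S7∕S9): with ★ `F0P3XiLocalLabelsOfMemXiFamily.locη_eq_and_locψ_eq_of_mem_cmSplitPacket_members` (the split member determines its labels) this is the
global half of «a discrete `P` ROUTED by `ξ` off a finite set and lying in the ξ′-envelope has `ξ = ξ′`» (family pin (J-a″), cofinite U♭).

## References
* J. Rogawski, *Automorphic Representations of Unitary Groups in Three Variables* (1990), §13.1 p. 199, §12.2 pp. 173–174, §4.13 Lemma 4.13.1 (b) [Rogawski1990].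
* J. W. S. Cassels, A. Fröhlich (eds.), *Algebraic Number Theory* (1967), Ch. VII (Tate) §4 Prop. 4.1; Ch. II §6 [CasselsFrohlichANT1967].
* V. Platonov, A. Rapinchuk, *Algebraic Groups and Number Theory* (1994), §7.3 Prop. 7.8 [PlatonovRapinchuk1994].
-/

set_option autoImplicit false

noncomputable section

open NumberField IsDedekindDomain
open Literature.NumberTheory.GaloisRepresentations
open Literature.NumberTheory.Automorphic Literature.NumberTheory.Automorphic.UnitaryGroup

namespace Literature.NumberTheory.Rogawski1990

namespace OneDimAutRepH

variable {L : Type} [Field L] [NumberField L] [IsCMField L]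

/-- **`ξ = ξ′` from the base changes at ONE place of each pair `{w, c̄ • w}`, OFF A FINITE SET `E`** (`torusCharacter_eq_of_split_of_not_mem'` for `η` and for `ψ`,
★ `OneDimAutRepH.ext`). [cite: Rogawski1990, §12.2 pp. 173–174] [cite: CasselsFrohlichANT1967, Ch. VII §4 Prop. 4.1] [cite: PlatonovRapinchuk1994, §7.3 Prop. 7.8] -/
theorem ext_of_bc_localComponent_eq_of_split_of_not_mem' {ξ ξ' : OneDimAutRepH L} (E : Finset (HeightOneSpectrum (𝓞 L)))
    (hη : ∀ w : HeightOneSpectrum (𝓞 L), IsCMField.complexConj L • w ≠ w → w ∉ E →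
      ξ.bcη.localComponent w = ξ'.bcη.localComponent w ∨
        ξ.bcη.localComponent (IsCMField.complexConj L • w) = ξ'.bcη.localComponent (IsCMField.complexConj L • w))
    (hψ : ∀ w : HeightOneSpectrum (𝓞 L), IsCMField.complexConj L • w ≠ w → w ∉ E →
      ξ.bcψ.localComponent w = ξ'.bcψ.localComponent w ∨
        ξ.bcψ.localComponent (IsCMField.complexConj L • w) = ξ'.bcψ.localComponent (IsCMField.complexConj L • w)) :
    ξ = ξ' :=
  OneDimAutRepH.ext
    (torusCharacter_eq_of_split_of_not_mem' (IsCMField.complexConj L) (Algebra.IsQuadraticExtension.finrank_eq_two _ L)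
      (IsCMField.complexConj_ne_one (K := L)) E ξ.η ξ'.η ξ.hη ξ'.hη hη)
    (torusCharacter_eq_of_split_of_not_mem' (IsCMField.complexConj L) (Algebra.IsQuadraticExtension.finrank_eq_two _ L)
      (IsCMField.complexConj_ne_one (K := L)) E ξ.ψ ξ'.ψ ξ.hψ ξ'.hψ hψ)

/-- **`ξ = ξ′` FROM `η̃_w = η̃′_w ∧ ψ̃_w = ψ̃′_w` AT ONE PLACE ABOVE EVERY SPLIT `v` OUTSIDE A FINITE SET `S₁` of places of `L⁺`** (the shape ★
`F0P3XiLocalLabelsOfMemXiFamily.bc_localComponent_eq_of_memXiFamily_witnesses` delivers place by place): the exceptional set upstairs is the (finite) set of places of `L`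
above `S₁`; the other place of the fibre `{w, c̄⁻¹ • w}` (★ `PlacesOver.eq_or_eq_galInv`) is carried by the split-place convention.
[cite: Rogawski1990, §13.1 p. 199; §12.2 pp. 173–174] [cite: CasselsFrohlichANT1967, Ch. VII §4 Prop. 4.1] [cite: PlatonovRapinchuk1994, §7.3 Prop. 7.8] -/
theorem ext_of_exists_bc_localComponent_eq_of_split_of_not_mem {ξ ξ' : OneDimAutRepH L} (S₁ : Finset (HeightOneSpectrum (𝓞 ↥(maximalRealSubfield L))))
    (h : ∀ v : HeightOneSpectrum (𝓞 ↥(maximalRealSubfield L)), v ∉ S₁ → (∃ w : PlacesOver L v, IsCMField.complexConj L • w.1 ≠ w.1) →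
      ∃ w : PlacesOver L v, ξ.bcη.localComponent w.1 = ξ'.bcη.localComponent w.1 ∧
        ξ.bcψ.localComponent w.1 = ξ'.bcψ.localComponent w.1) :
    ξ = ξ' := by
  classical
  have hc := IsCMField.complexConj_ne_one (K := L)
  set E : Finset (HeightOneSpectrum (𝓞 L)) := S₁.biUnion fun v => (Finset.univ : Finset (PlacesOver L v)).image fun w => w.1 with hE
  have hunder : ∀ w : HeightOneSpectrum (𝓞 L), w ∉ E → w.under (𝓞 ↥(maximalRealSubfield L)) ∉ S₁ := fun w hw hv =>
    hw (Finset.mem_biUnion.2 ⟨w.under _, hv, Finset.mem_image.2 ⟨⟨w, rfl⟩, Finset.mem_univ _, rfl⟩⟩)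
  have key : ∀ w : HeightOneSpectrum (𝓞 L), IsCMField.complexConj L • w ≠ w → w ∉ E →
      (ξ.bcη.localComponent w = ξ'.bcη.localComponent w ∧ ξ.bcψ.localComponent w = ξ'.bcψ.localComponent w) ∨
        (ξ.bcη.localComponent (IsCMField.complexConj L • w) = ξ'.bcη.localComponent (IsCMField.complexConj L • w) ∧
          ξ.bcψ.localComponent (IsCMField.complexConj L • w) = ξ'.bcψ.localComponent (IsCMField.complexConj L • w)) := by
    intro w hw hwE
    obtain ⟨w₀, hη₀, hψ₀⟩ := h (w.under _) (hunder w hwE) ⟨⟨w, rfl⟩, hw⟩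
    rcases PlacesOver.eq_or_eq_galInv (IsCMField.complexConj L) hc ⟨w, rfl⟩ w₀ with h₀ | h₀
    · left
      rw [h₀] at hη₀ hψ₀
      exact ⟨hη₀, hψ₀⟩
    · right
      rw [h₀] at hη₀ hψ₀
      change ξ.bcη.localComponent (_⁻¹ • w) = ξ'.bcη.localComponent (_⁻¹ • w) at hη₀
      change ξ.bcψ.localComponent (_⁻¹ • w) = ξ'.bcψ.localComponent (_⁻¹ • w) at hψ₀
      rw [inv_smul_place (IsCMField.complexConj L) (Algebra.IsQuadraticExtension.finrank_eq_two _ L) hc] at hη₀ hψ₀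
      exact ⟨hη₀, hψ₀⟩
  refine ext_of_bc_localComponent_eq_of_split_of_not_mem' E (fun w hw hwE => ?_) (fun w hw hwE => ?_)
  · rcases key w hw hwE with ⟨hη, -⟩ | ⟨hη, -⟩
    · exact Or.inl hη
    · exact Or.inr hη
  · rcases key w hw hwE with ⟨-, hψ⟩ | ⟨-, hψ⟩
    · exact Or.inl hψ
    · exact Or.inr hψ

/-- **`ξ = ξ′` FROM THE D6 LABELS `(locη, locψ)` AT ONE PLACE ABOVE EVERY SPLIT `v ∉ S₁`.** [cite: Rogawski1990, §13.1 p. 199; §12.2 pp. 173–174]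
[cite: CasselsFrohlichANT1967, Ch. VII §4 Prop. 4.1] -/
theorem ext_of_locLabels_eq_of_split_of_not_mem {ξ ξ' : OneDimAutRepH L} (S₁ : Finset (HeightOneSpectrum (𝓞 ↥(maximalRealSubfield L))))
    (h : ∀ v : HeightOneSpectrum (𝓞 ↥(maximalRealSubfield L)), v ∉ S₁ → (∃ w : PlacesOver L v, IsCMField.complexConj L • w.1 ≠ w.1) →
      ∃ w : PlacesOver L v, ξ.locη w.1 = ξ'.locη w.1 ∧ ξ.locψ w.1 = ξ'.locψ w.1) :
    ξ = ξ' :=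
  ext_of_exists_bc_localComponent_eq_of_split_of_not_mem S₁ fun v hv hs => by
    obtain ⟨w, hη, hψ⟩ := h v hv hs
    exact ⟨w, bcη_localComponent_eq_of_locη_eq hη, bcψ_localComponent_eq_of_locψ_eq hψ⟩

/-- **`ξ = ξ′` FROM THE SPLIT MEMBERS' LABELS `(splitν₀ μω, locψ)` AT ONE PLACE ABOVE EVERY SPLIT `v ∉ S₁`**, for ONE auxiliary Hecke character `μω` — the labels of
★ `cmSplitPacket` ∕ ★ `IsXiLocalFamily`, so that ★ `F0P3XiLocalLabelsOfMemXiFamily.splitLabels_eq_of_mem_cmSplitPacket_members` feeds it directly.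
[cite: Rogawski1990, §13.1 p. 199; §4.13 Lemma 4.13.1 (b)] [cite: CasselsFrohlichANT1967, Ch. VII §4 Prop. 4.1] [cite: PlatonovRapinchuk1994, §7.3 Prop. 7.8] -/
theorem ext_of_splitLabels_eq_of_split_of_not_mem {ξ ξ' : OneDimAutRepH L} (μω : HeckeCharacter L)
    (S₁ : Finset (HeightOneSpectrum (𝓞 ↥(maximalRealSubfield L))))
    (h : ∀ v : HeightOneSpectrum (𝓞 ↥(maximalRealSubfield L)), v ∉ S₁ → (∃ w : PlacesOver L v, IsCMField.complexConj L • w.1 ≠ w.1) →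
      ∃ w : PlacesOver L v, ξ.splitν₀ μω w.1 = ξ'.splitν₀ μω w.1 ∧ ξ.locψ w.1 = ξ'.locψ w.1) :
    ξ = ξ' :=
  ext_of_locLabels_eq_of_split_of_not_mem S₁ fun v hv hs => by
    obtain ⟨w, hν, hψ⟩ := h v hv hs
    exact ⟨w, locη_eq_of_splitν₀_eq μω hν hψ, hψ⟩

end OneDimAutRepH

end Literature.NumberTheory.Rogawski1990

end
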